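import Summits.AtomisticToContinuum.Crystallization.Theorems.LoopTunnelDialSieveCurrency

/-!
# LoopTunnelDial — DEPTH DIAL with the separation clause (lens-5 generations 17R/18; helper vocabulary of crux `PocketCase`, stmt-AtomisticToContinuum-27294)

Landing kit file 1/5 of the CONTACT DIAL preview (`HOME/decomp-a2c-lens-5/g18/preview/line-pocket-contact-v81.lean`), over the landed
`LoopTunnelDialSieveCurrency`.  Contents: `SepNear`, DEEP¾ `DeepFarCanonSep r s` (the repaired depth piece: canonical improvability OR a pair
closer than `3/4` near deep far matter — the K-D1 witness, clamped fcc at nn `0.72`, has such pairs), SHORT `ShortCertified s`, the bridge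
`DEEP¾ ∧ SHORT ∧ THIN ⟹ FarCertified`, the GS rung `NoDeepFarGS s` with the bridge re-seated on it, and the warm-site surgery lemma.
All `[folklore]` bookkeeping; 0 sorry.
-/

noncomputable section

open scoped BigOperators Classical InnerProductSpace
open Literature.MathematicalPhysics.StatisticalMechanics
open Literature.MathematicalPhysics.StatisticalMechanics.Yuhjtman2015 (hLJ)
open Summit.AtomisticToContinuum.Crystallization.Theorems.GrainPercolationDialCrossCeiling (E3 ballChunk)
open Summit.AtomisticToContinuum.Crystallization.Theorems.ChargedEnergyGapNegative (eStar)
open Summit.AtomisticToContinuum.Crystallization.Theorems.LjLaminarWindowsSketch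
  (lennardJones_groundState_dist_ge_seven_tenths forceBalance_sum_deriv_eq_zero forceBalance_one_le_sum_hLJ hLJ' kF)
open Summit.AtomisticToContinuum.Crystallization.Theorems.LoopTunnelDialLocalSurgery (improvable_mono)
open Summit.AtomisticToContinuum.Crystallization.Theorems.LoopTunnelDialSieveCurrency

namespace Summit.AtomisticToContinuum.Crystallization.Theorems.LoopTunnelDialDepthSep

variable {N : ℕ}

/-! ## GENERATION 17-R «DEPTH DIAL, REPAIRED» (cell critic row 217, kill-candidate K-D1 ACCEPTED): over-compressed close packing
(nearest-neighbour distance in `[7/10, 3/4)`) is FAR MATTER for the sieve — its scale floor `3/4 ≤ d` makes every particle whose `3`-ball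
contains a pair closer than `3/4` uncertifiable —, and a CLAMPED energy minimiser of such matter is, by minimality, NOT canonically
improvable at any radius inside the clamp: `DeepFarCanon 32 32` as posed in generation 17 is refuted in substance by matter no ground
state contains (GS-freeness exposes the floor).  REPAIR (the critic's (r2) with the compressed alternative routed through the DOOR's own
currency instead of a canonical `GS¾`): DEEP keeps its canonical, `e⋆`-free, GS-free form but only on matter that is `3/4`-SEPARATED
around the deep-far particle (`DeepFarCanonSep`), and the compressed alternative becomes a third door piece `ShortCertified s` — ground
states carrying an `s`-deep-far particle with a pair closer than `3/4` within `s + 9` of it are `(e⋆, g, s₀)`-improvable somewhere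
(plan: DELETE the compressed particle — `LoopTunnelDialLocalSurgery.improvable_of_le_siteEnergy` — once a one-centre attractive-load
bound `L(7/10) ≤ 1.69 − e⋆ − g` is certified; the canonical `GS¾` would need `L(7/10) < 1.69`).  Bridge: DEEP¾ ∧ SHORT ∧ THIN ⟹ door,
and door ⟹ SHORT ∧ THIN (both residual pieces are RESTRICTIONS of `FarCertified`). -/

/-- `SepNear ρ R y c` — the configuration is `ρ`-separated on the closed `R`-ball about the particle `y c`. [line vocabulary · LoopTunnelDial contact dial · crux stmt-AtomisticToContinuum-27294 · definition, not a cited fact] -/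
def SepNear (ρ R : ℝ) {N : ℕ} (y : Fin N → E3) (c : Fin N) : Prop :=
  ∀ k l : Fin N, k ≠ l → dist (y k) (y c) ≤ R → dist (y l) (y c) ≤ R → ρ ≤ dist (y k) (y l)

/-- **DEEP¾ `DeepFarCanonSep r s`** (GS-free, `μ`-free, `e⋆`-free, `N`-free): every injective `7/10`-separated configuration which is
`3/4`-SEPARATED on the closed `(s+9)`-ball about an `s`-deep-far particle `c` (so the sieve's scale floor is not what makes the matter
far) is CANONICALLY improvable within radius `r` about `y c`. [line vocabulary · LoopTunnelDial contact dial · crux stmt-AtomisticToContinuum-27294 · definition, not a cited fact] -/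
def DeepFarCanonSep (r s : ℝ) : Prop :=
  ∀ (N : ℕ) (y : Fin N → E3), Function.Injective y → (∀ i j : Fin N, i ≠ j → (7 : ℝ) / 10 ≤ dist (y i) (y j)) →
    ∀ c : Fin N, DeepFar s y c → SepNear (3 / 4) (s + 9) y c → CanonImprovable r y c

/-- `ShortDeepFar s y` — some `s`-deep-far particle has a pair of particles closer than `3/4` within `s + 9` of it
(deep far matter that is far BECAUSE it is over-compressed somewhere nearby). [line vocabulary · LoopTunnelDial contact dial · crux stmt-AtomisticToContinuum-27294 · definition, not a cited fact] -/
def ShortDeepFar (s : ℝ) {N : ℕ} (y : Fin N → E3) : Prop :=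
  ∃ c : Fin N, DeepFar s y c ∧ ¬ SepNear (3 / 4) (s + 9) y c

/-- **`ShortPairCertificate s N₀ s₀ g`** — every Lennard-Jones ground state on `N ≥ N₀` particles with SHORT deep far matter
(`ShortDeepFar s`) admits a radius-`s₀` local surgery about some particle improving the grand potential at `e⋆` by `g`. [line vocabulary · LoopTunnelDial contact dial · crux stmt-AtomisticToContinuum-27294 · definition, not a cited fact] -/
def ShortPairCertificate (s : ℝ) (N₀ : ℕ) (s₀ g : ℝ) : Prop :=
  ∀ N : ℕ, N₀ ≤ N → ∀ y : Fin N → E3, IsGroundState lennardJones y → ShortDeepFar s y → ∃ c : Fin N, Improvable eStar g s₀ y c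

/-- **SHORT `ShortCertified s`** — the door RESTRICTED to ground states with short deep far matter.  (Plan: the compressed particle is
HOT — delete it.) [line vocabulary · LoopTunnelDial contact dial · crux stmt-AtomisticToContinuum-27294 · definition, not a cited fact] -/
def ShortCertified (s : ℝ) : Prop :=
  ∃ N₀ : ℕ, ∃ s₀ g : ℝ, 0 ≤ s₀ ∧ 0 < g ∧ ShortPairCertificate s N₀ s₀ g

/-! ### Kernels -/

/-- The old DEEP implies the repaired one (DEEP¾ is WEAKER: one more hypothesis). -/
theorem deepFarCanonSep_of_deepFarCanon {r s : ℝ} (h : DeepFarCanon r s) : DeepFarCanonSep r s :=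
  fun N y hy hsep c hc _ => h N y hy hsep c hc

/-- DEEP¾ is monotone in the radius (larger `r` is weaker). -/
theorem deepFarCanonSep_mono {r r' s : ℝ} (hr : r ≤ r') (h : DeepFarCanonSep r s) : DeepFarCanonSep r' s :=
  fun N y hy hsep c hc hs => canonImprovable_mono hr (h N y hy hsep c hc hs)

/-- A `ρ`-separated configuration is `ρ`-separated near every particle. -/
theorem sepNear_of_forall {ρ R : ℝ} {y : Fin N → E3} (h : ∀ i j : Fin N, i ≠ j → ρ ≤ dist (y i) (y j)) (c : Fin N) :
    SepNear ρ R y c := fun k l hkl _ _ => h k l hkl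

/-- Under DEEP¾, a ground state's deep far matter is SHORT: every `s`-deep-far particle of a ground state has a pair closer than `3/4`
within `s + 9` (ground states are canonically stable for free, `not_canonImprovable_of_isGroundState`). -/
theorem not_sepNear_of_isGroundState_deepFar {r s : ℝ} (hD : DeepFarCanonSep r s) {y : Fin N → E3}
    (hy : IsGroundState lennardJones y) {c : Fin N} (hc : DeepFar s y c) : ¬ SepNear (3 / 4) (s + 9) y c := fun hs =>
  not_canonImprovable_of_isGroundState hy r c
    (hD N y hy.1 (fun _ _ hij => lennardJones_groundState_dist_ge_seven_tenths hy hij) c hc hs)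

/-- Under DEEP¾ a ground state is either `s`-SHALLOW-far or has SHORT deep far matter. -/
theorem shallowFar_or_shortDeepFar {r s : ℝ} (hD : DeepFarCanonSep r s) {y : Fin N → E3} (hy : IsGroundState lennardJones y) :
    ShallowFar s y ∨ ShortDeepFar s y := by
  by_cases h : ∃ c : Fin N, DeepFar s y c
  · obtain ⟨c, hc⟩ := h
    exact Or.inr ⟨c, hc, not_sepNear_of_isGroundState_deepFar hD hy hc⟩
  · push Not at h
    exact Or.inl fun i _ => h i

/-- Weakening a surgery certificate's margin and radius (the tree's `LoopTunnelDialLocalSurgery.improvable_mono`, read through `Improvable`). -/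
theorem improvable_weaken {e η η' R R' : ℝ} (hη : η' ≤ η) (hR : R ≤ R') (hR0 : 0 ≤ R) {y : Fin N → E3} {c : Fin N}
    (h : Improvable e η R y c) : Improvable e η' R' y c :=
  improvable_mono hη hR hR0 h

/-- **THE REPAIRED BRIDGE (PROVED): DEEP¾ ∧ SHORT ∧ THIN ⟹ the door `FarCertified`.**  A large ground state with a far particle is either
shallow-far (THIN certifies it) or has short deep far matter (SHORT certifies it); the two certificates are merged by taking the larger
threshold and radius and the smaller margin (`improvable_weaken`). -/
theorem farCertified_of_deepSep_short_thin {r s : ℝ} (hD : DeepFarCanonSep r s) (hS : ShortCertified s) (hT : ThinCertified s) :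
    FarCertified := by
  obtain ⟨N₁, s₁, g₁, hs₁, hg₁, hS⟩ := hS
  obtain ⟨N₂, s₂, g₂, hs₂, hg₂, hT⟩ := hT
  refine ⟨max N₁ N₂, max s₁ s₂, min g₁ g₂, le_max_of_le_left hs₁, lt_min hg₁ hg₂, fun N hN y hy hfar => ?_⟩
  rcases shallowFar_or_shortDeepFar hD hy with hsh | hsd
  · obtain ⟨c, hc⟩ := hT N ((le_max_right _ _).trans hN) y hy hsh hfar
    exact ⟨c, improvable_weaken (min_le_right _ _) (le_max_right _ _) hs₂ hc⟩
  · obtain ⟨c, hc⟩ := hS N ((le_max_left _ _).trans hN) y hy hsd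
    exact ⟨c, improvable_weaken (min_le_left _ _) (le_max_left _ _) hs₁ hc⟩

/-- **SHORT is WEAKER than the door (PROVED)** — a restriction of `FarCertified` (a deep-far particle is far, `0 ≤ s`). -/
theorem shortCertified_of_farCertified {s : ℝ} (hs : 0 ≤ s) (h : FarCertified) : ShortCertified s := by
  obtain ⟨N₀, s₀, g, hs₀, hg, h⟩ := h
  exact ⟨N₀, s₀, g, hs₀, hg, fun N hN y hy ⟨c, hc, _⟩ => h N hN y hy ⟨c, mem_farSet_of_deepFar hs hc⟩⟩

/-- Given DEEP¾, the door is EQUIVALENT to SHORT ∧ THIN (for `0 ≤ s`). -/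
theorem farCertified_iff_short_thin {r s : ℝ} (hs : 0 ≤ s) (hD : DeepFarCanonSep r s) :
    FarCertified ↔ ShortCertified s ∧ ThinCertified s :=
  ⟨fun h => ⟨shortCertified_of_farCertified hs h, thinCertified_of_farCertified s h⟩,
    fun h => farCertified_of_deepSep_short_thin hD h.1 h.2⟩

/-- SHORT's plan, kernel form (PROVED, GS-free): if some particle `i` within `R` of `y c` has site energy at least `e⋆ + g`, the
configuration is `(e⋆, g, R)`-improvable about `c` (delete `i`; the tree's `improvable_of_le_siteEnergy`).  For the compressed particle of a
short pair, `𝓔ⁱ ≥ V(3/4) − L(7/10) = 1.69… − L`, so SHORT follows once a one-centre load bound `L(7/10) ≤ 1.69 − e⋆ − g` is certified. -/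
theorem improvable_of_warmSite {g R : ℝ} {y : Fin N → E3} (hy : Function.Injective y) (hR : 0 < R) {i c : Fin N}
    (hic : dist (y i) (y c) ≤ R) (h : eStar + g ≤ siteEnergy lennardJones y i) : Improvable eStar g R y c :=
  Summit.AtomisticToContinuum.Crystallization.Theorems.LoopTunnelDialLocalSurgery.improvable_of_le_siteEnergy hy hR hic h

/-- The short partner bond is REPULSIVE by at least `V(3/4) = (4/3)¹²/12 − (4/3)⁶/6 = 1.694…`: `V_LJ(t) ≥ 169/100` for `0 < t < 3/4`
(`V` is decreasing on `(0, 1]`). -/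
theorem lennardJones_ge_of_lt_three_quarters {t : ℝ} (h0 : 0 < t) (ht : t < 3 / 4) : 169 / 100 ≤ lennardJones t := by
  unfold lennardJones
  have hinv : (3 / 4 : ℝ)⁻¹ ≤ t⁻¹ := by
    rw [inv_le_inv₀ (by norm_num) h0]; exact ht.le
  have h43 : (4 / 3 : ℝ) ≤ t⁻¹ := by simpa using hinv
  have h6 : (4 / 3 : ℝ) ^ 6 ≤ (t⁻¹) ^ 6 := pow_le_pow_left₀ (by norm_num) h43 6
  have hu0 : 0 ≤ (t⁻¹) ^ 6 := pow_nonneg (inv_nonneg.2 h0.le) 6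
  have h12 : (t⁻¹) ^ 12 = ((t⁻¹) ^ 6) ^ 2 := by ring
  rw [h12]
  -- with u = t⁻⁶ ≥ u₀ = (4/3)⁶ = 4096/729: u²/12 − u/6 − (u₀²/12 − u₀/6) = (u − u₀)(u + u₀ − 2)/12 ≥ 0, and the value at u₀ is 1.694…
  have hu : (4096 : ℝ) / 729 ≤ (t⁻¹) ^ 6 := by
    have : ((4 : ℝ) / 3) ^ 6 = 4096 / 729 := by norm_num
    linarith [h6]
  nlinarith [mul_nonneg (sub_nonneg.2 hu) (by linarith : (0 : ℝ) ≤ (t⁻¹) ^ 6 + 4096 / 729 - 2)]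

/-! ### §18.1 DEEP ladder -/

/-- **`NoDeepFarGS s`** — the GROUND-STATE SEAT of the depth dial: in every Lennard-Jones ground state (any `N`), every `s`-deep-far particle
carries a pair closer than `3/4` within `s + 9` of it (no ground state has `3/4`-separated `s`-deep far matter).  This is EXACTLY what the
bridge consumes; DEEP¾ at ANY radius implies it, so re-filing DEEP¾ at a larger radius numeral never touches the composition. [WEAKER than
DEEP¾ (a consequence about ground states only); not GS-free, hence not the instrument — the instrument stays `DeepFarCanonSep r s`.] [line vocabulary · LoopTunnelDial contact dial · crux stmt-AtomisticToContinuum-27294 · definition, not a cited fact] -/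
def NoDeepFarGS (s : ℝ) : Prop :=
  ∀ (N : ℕ) (y : Fin N → E3), IsGroundState lennardJones y → ∀ c : Fin N, DeepFar s y c → ¬ SepNear (3 / 4) (s + 9) y c

/-- **DEEP∃ `DeepSepExists s`** — DEEP¾ at SOME re-seeding radius. [line vocabulary · LoopTunnelDial contact dial · crux stmt-AtomisticToContinuum-27294 · definition, not a cited fact] -/
def DeepSepExists (s : ℝ) : Prop := ∃ r : ℝ, DeepFarCanonSep r s

/-- DEEP¾ at radius `r` gives DEEP∃. [folklore] -/
theorem deepSepExists_of_deepFarCanonSep {r s : ℝ} (h : DeepFarCanonSep r s) : DeepSepExists s := ⟨r, h⟩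

/-- DEEP¾ (any radius) ⟹ the GS rung. -/
theorem noDeepFarGS_of_deepFarCanonSep {r s : ℝ} (h : DeepFarCanonSep r s) : NoDeepFarGS s :=
  fun _ _ hy _ hc => not_sepNear_of_isGroundState_deepFar h hy hc

/-- DEEP∃ implies the GS rung. [folklore] -/
theorem noDeepFarGS_of_deepSepExists {s : ℝ} (h : DeepSepExists s) : NoDeepFarGS s := by
  obtain ⟨r, h⟩ := h
  exact noDeepFarGS_of_deepFarCanonSep h

/-- Under the GS rung every ground state is `s`-SHALLOW or has a SHORT pair near deep far matter. -/
theorem shallowFar_or_shortDeepFar_of_noDeep {s : ℝ} (hD : NoDeepFarGS s) {y : Fin N → E3} (hy : IsGroundState lennardJones y) :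
    ShallowFar s y ∨ ShortDeepFar s y := by
  by_cases h : ∃ c : Fin N, DeepFar s y c
  · obtain ⟨c, hc⟩ := h
    exact Or.inr ⟨c, hc, hD N y hy c hc⟩
  · push Not at h
    exact Or.inl fun i _ => h i

/-- **THE BRIDGE ON THE GS RUNG (PROVED).** `NoDeepFarGS s ∧ SHORT(s) ∧ THIN(s) ⟹ FarCertified`. -/
theorem farCertified_of_noDeep_short_thin {s : ℝ} (hD : NoDeepFarGS s) (hS : ShortCertified s) (hT : ThinCertified s) : FarCertified := by
  obtain ⟨N₁, s₁, g₁, hs₁, hg₁, hS⟩ := hS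
  obtain ⟨N₂, s₂, g₂, hs₂, hg₂, hT⟩ := hT
  refine ⟨max N₁ N₂, max s₁ s₂, min g₁ g₂, le_max_of_le_left hs₁, lt_min hg₁ hg₂, fun N hN y hy hfar => ?_⟩
  rcases shallowFar_or_shortDeepFar_of_noDeep hD hy with hsh | hsd
  · obtain ⟨c, hc⟩ := hT N ((le_max_right _ _).trans hN) y hy hsh hfar
    exact ⟨c, improvable_weaken (min_le_right _ _) (le_max_right _ _) hs₂ hc⟩
  · obtain ⟨c, hc⟩ := hS N ((le_max_left _ _).trans hN) y hy hsd
    exact ⟨c, improvable_weaken (min_le_left _ _) (le_max_left _ _) hs₁ hc⟩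

/-- On the GS rung the door is EXACTLY SHORT ∧ THIN (PROVED). -/
theorem farCertified_iff_short_thin_of_noDeep {s : ℝ} (hs : 0 ≤ s) (hD : NoDeepFarGS s) :
    FarCertified ↔ ShortCertified s ∧ ThinCertified s :=
  ⟨fun h => ⟨shortCertified_of_farCertified hs h, thinCertified_of_farCertified s h⟩,
    fun h => farCertified_of_noDeep_short_thin hD h.1 h.2⟩

end Summit.AtomisticToContinuum.Crystallization.Theorems.LoopTunnelDialDepthSep

end
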